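import Summits.AtomisticToContinuum.Crystallization.Theses.SpectralChargeLedger
import Summits.AtomisticToContinuum.Crystallization.Theses.PhononSlackCertificates

/-!
# Route `SpectralChargeLedger`, crux `SummedShellPricing` (stmt-AtomisticToContinuum-17044, K1),
# line `Sketch`: stub `stub_torusGlue` — TORUS TWO-SHELL GAP ∧ TORUS EXACT-CELL COERCIVITY ⇒ TORUS K1

On the torus (periodic configurations `P` of `ℝ³` with `1/3`-separated point set; `m := #motif > 0`)
two inequalities are given:

* the torus two-shell gap (hub crux 13956 in torus form): `e⋆ + g·#gross/m ≤ e(P)` with `g > 0`,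
  `gross = {q ∈ motif : ¬ IsTwoShellGoodSet (1/20) (47/50) 1 P.points q}`, `e⋆ = ⨅_Q e(Q)`;
* exact-cell coercivity: one cell `(a₀,h₀)` in the box, `C ≥ 0`, and for every `τ ∈ (0,1]` a `c > 0`
  with `c·#mild − C·#gross ≤ m·(e(P) − e⋆)`, `mild = {q ∈ motif : q is τ-bad ∧ two-shell-good}`.

CONCLUSION (torus K1, same cell): for every `τ ∈ (0,1]`, with `κ := min g (c·g/(g+C)) / 2 > 0`,
`κ·#bad ≤ m·(e(P) − e⋆)`, `bad = {q ∈ motif : q is τ-bad}`.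

PROOF.  (1) Multiply the gap by `m > 0`: `g·#gross ≤ m·(e − e⋆) =: X`.  (2) A τ-bad motif point is
either (τ-bad and two-shell-good) or two-shell-bad, so `#bad ≤ #mild + #gross` (an abstract
counting lemma over a `Finset` and two predicates; the goodness predicates are never unfolded).
(3) Pure real algebra: with `κ' := c·g/(g+C)` one has `κ'·(g+C) = c·g`, `X ≥ 0`,
`c·g·#mild ≤ (g+C)·X` (add `g ×` coercivity and `C ×` gap), hence `κ'·#mild ≤ X` and
`min g κ' / 2 · (#mild + #gross) ≤ (κ'·#mild + g·#gross)/2 ≤ X`.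
Step (3) is a port of `summedShellPricing_of_gap_of_coercivity`
(`Summits/AtomisticToContinuum/Crystallization/Cruxes/SummedShellPricing/IdeatorOneSketch.lean`).
No definition, no named fact; all `[folklore]`.
-/

noncomputable section

namespace Summit.AtomisticToContinuum.Crystallization.Theorems.SummedShellPricingTorusGlue

open scoped BigOperators Classical
open Literature.MathematicalPhysics.StatisticalMechanics Literature.Geometry.DiscreteGeometry

/-- **Counting.**  For a finite set `s` and two predicates `Bd`, `Tg`: every element satisfying `Bd`
satisfies `Bd ∧ Tg` or `¬ Tg`, so `#{Bd} ≤ #{Bd ∧ Tg} + #{¬ Tg}` (cast to `ℝ`).  The decidability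
instances are arbitrary implicit arguments, so the lemma unifies with any elaborated filters.
[folklore] -/
theorem card_filter_le_card_filter_and_add {α : Type*} (s : Finset α) (Bd Tg : α → Prop)
    {_ : DecidablePred Bd} {_ : DecidablePred fun q => Bd q ∧ Tg q}
    {_ : DecidablePred fun q => ¬ Tg q} :
    ((s.filter Bd).card : ℝ) ≤
      ((s.filter fun q => Bd q ∧ Tg q).card : ℝ) + ((s.filter fun q => ¬ Tg q).card : ℝ) := by
  have hsub : s.filter Bd ⊆ (s.filter fun q => Bd q ∧ Tg q) ∪ (s.filter fun q => ¬ Tg q) := by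
    intro q hq
    rw [Finset.mem_filter] at hq
    rw [Finset.mem_union, Finset.mem_filter, Finset.mem_filter]
    by_cases hT : Tg q
    · exact Or.inl ⟨hq.1, hq.2, hT⟩
    · exact Or.inr ⟨hq.1, hT⟩
  exact_mod_cast (Finset.card_le_card hsub).trans (Finset.card_union_le _ _)

-- adapted from Summits/AtomisticToContinuum/Crystallization/Cruxes/SummedShellPricing/IdeatorOneSketch.lean
-- (summedShellPricing_of_gap_of_coercivity, step (4) algebra)
/-- **Algebra of the glue.**  From the gap `e⋆ + g·G/m ≤ e` (`m > 0`), coercivity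
`c·M − C·G ≤ m·(e − e⋆)` and the count `B ≤ M + G` (`M, G ≥ 0`), the convex combination
`κ := min g (c·g/(g+C)) / 2` prices `B`: `κ·B ≤ m·(e − e⋆)`. [folklore] -/
theorem min_div_two_mul_le {g c C m B M G e es : ℝ} (hg : 0 < g) (hc : 0 < c) (hC : 0 ≤ C)
    (hm : 0 < m) (h1 : es + g * G / m ≤ e) (h2 : c * M - C * G ≤ m * (e - es)) (hB : B ≤ M + G)
    (hM0 : 0 ≤ M) (hG0 : 0 ≤ G) :
    min g (c * g / (g + C)) / 2 * B ≤ m * (e - es) := by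
  set X : ℝ := m * (e - es) with hX
  -- (1) clear the division in the gap: g·G ≤ X
  have h1' : g * G ≤ X := by
    have h : g * G / m ≤ e - es := by linarith
    rw [div_le_iff₀ hm] at h
    rw [hX]; linarith
  have hgC : 0 < g + C := by linarith
  set κ' : ℝ := c * g / (g + C) with hκ'
  have hκ'pos : 0 < κ' := div_pos (mul_pos hc hg) hgC
  have hκ'eq : κ' * (g + C) = c * g := by rw [hκ']; field_simp
  have hX0 : 0 ≤ X := le_trans (mul_nonneg hg.le hG0) h1'
  -- (2) κ'·M ≤ X
  have h3 : κ' * M ≤ X := by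
    have h4 : c * g * M ≤ (g + C) * X := by nlinarith [h1', h2, hC, hg, hM0, hX0]
    have h5 : κ' * (g + C) * M ≤ (g + C) * X := by rw [hκ'eq]; exact h4
    have h6 : (g + C) * (κ' * M) ≤ (g + C) * X := by linarith [h5]
    exact le_of_mul_le_mul_left h6 hgC
  -- (3) convex combination
  have hminle1 : min g κ' ≤ g := min_le_left _ _
  have hminle2 : min g κ' ≤ κ' := min_le_right _ _
  have hmin0 : 0 ≤ min g κ' := (lt_min hg hκ'pos).le
  calc min g κ' / 2 * B ≤ min g κ' / 2 * (M + G) :=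
        mul_le_mul_of_nonneg_left hB (by positivity)
    _ = (min g κ' * M + min g κ' * G) / 2 := by ring
    _ ≤ (κ' * M + g * G) / 2 := by gcongr
    _ ≤ X := by linarith [h1', h3]

/-- **Stub 2 — torus glue (M): torus two-shell gap ∧ torus exact-cell coercivity ⇒ torus K1.**  With `g`
from the gap and `(C, c(τ))` from coercivity put `κ := min g (c·g/(g+C)) / 2`; for a motif point `q`,
τ-bad ⇒ (τ-bad ∧ two-shell-good) ∨ two-shell-bad, so `#bad_τ ≤ #mild + #gross`; `g·#gross ≤ m·(e − e⋆)`
(gap, multiplied by `m = #motif > 0`) and `c·#mild − C·#gross ≤ m·(e − e⋆)` combine convexly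
(port of `IdeatorOneSketch.summedShellPricing_of_gap_of_coercivity` to the torus). [folklore] -/
theorem stub_torusGlue :
    (∃ g : ℝ, 0 < g ∧ ∀ P : PeriodicConfiguration 3,
         (∀ u ∈ P.points, ∀ v ∈ P.points, u ≠ v → (1 / 3 : ℝ) ≤ dist u v) →
         (⨅ Q : PeriodicConfiguration 3, Q.energyPerParticle lennardJones)
           + g * ((P.motif.filter fun y => ¬ IsTwoShellGoodSet (1 / 20) (47 / 50) 1 P.points y).card : ℝ)
               / (P.motif.card : ℝ)
           ≤ P.energyPerParticle lennardJones) →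
    (∃ a₀ h₀ : ℝ, 47 / 50 ≤ a₀ ∧ a₀ ≤ 1 ∧ |h₀ - a₀ * Real.sqrt (2 / 3)| ≤ a₀ / 100 ∧
       ∃ C : ℝ, 0 ≤ C ∧ ∀ τ : ℝ, 0 < τ → τ ≤ 1 → ∃ c : ℝ, 0 < c ∧
         ∀ P : PeriodicConfiguration 3, (∀ u ∈ P.points, ∀ v ∈ P.points, u ≠ v → (1 / 3 : ℝ) ≤ dist u v) →
           c * ((P.motif.filter fun q =>
               ¬ (∃ A : EuclideanSpace ℝ (Fin 3) →ₗᵢ[ℝ] EuclideanSpace ℝ (Fin 3),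
                   (∃ e : ↥{z : EuclideanSpace ℝ (Fin 3) | z ∈ P.points ∧ z ≠ q ∧ dist z (q) < 13 / 10 * a₀} ≃
                       ↥{p : EuclideanSpace ℝ (Fin 3) | p ∈ hcpStacking a₀ h₀ ∧ p ≠ 0 ∧ ‖p‖ < 13 / 10 * a₀},
                     ∀ t : ↥{z : EuclideanSpace ℝ (Fin 3) | z ∈ P.points ∧ z ≠ q ∧ dist z (q) < 13 / 10 * a₀},
                       dist ((t : EuclideanSpace ℝ (Fin 3)) - q)
                         (A ((e t : ↥{p : EuclideanSpace ℝ (Fin 3) | p ∈ hcpStacking a₀ h₀ ∧ p ≠ 0 ∧ ‖p‖ < 13 / 10 * a₀}) : EuclideanSpace ℝ (Fin 3))) ≤ τ) ∨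
                   (∃ e : ↥{z : EuclideanSpace ℝ (Fin 3) | z ∈ P.points ∧ z ≠ q ∧ dist z (q) < 13 / 10 * a₀} ≃
                       ↥{p : EuclideanSpace ℝ (Fin 3) | p ∈ fccStacking a₀ h₀ ∧ p ≠ 0 ∧ ‖p‖ < 13 / 10 * a₀},
                     ∀ t : ↥{z : EuclideanSpace ℝ (Fin 3) | z ∈ P.points ∧ z ≠ q ∧ dist z (q) < 13 / 10 * a₀},
                       dist ((t : EuclideanSpace ℝ (Fin 3)) - q)
                         (A ((e t : ↥{p : EuclideanSpace ℝ (Fin 3) | p ∈ fccStacking a₀ h₀ ∧ p ≠ 0 ∧ ‖p‖ < 13 / 10 * a₀}) : EuclideanSpace ℝ (Fin 3))) ≤ τ)) ∧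
               IsTwoShellGoodSet (1 / 20) (47 / 50) 1 P.points q).card : ℝ)
             - C * ((P.motif.filter fun q => ¬ IsTwoShellGoodSet (1 / 20) (47 / 50) 1 P.points q).card : ℝ)
           ≤ (P.motif.card : ℝ) * (P.energyPerParticle lennardJones - (⨅ Q : PeriodicConfiguration 3, Q.energyPerParticle lennardJones))) →
    ∃ a₀ h₀ : ℝ, 47 / 50 ≤ a₀ ∧ a₀ ≤ 1 ∧ |h₀ - a₀ * Real.sqrt (2 / 3)| ≤ a₀ / 100 ∧
      ∀ τ : ℝ, 0 < τ → τ ≤ 1 → ∃ κ : ℝ, 0 < κ ∧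
        ∀ P : PeriodicConfiguration 3, (∀ u ∈ P.points, ∀ v ∈ P.points, u ≠ v → (1 / 3 : ℝ) ≤ dist u v) →
          κ * ((P.motif.filter fun q =>
              ¬ (∃ A : EuclideanSpace ℝ (Fin 3) →ₗᵢ[ℝ] EuclideanSpace ℝ (Fin 3),
                  (∃ e : ↥{z : EuclideanSpace ℝ (Fin 3) | z ∈ P.points ∧ z ≠ q ∧ dist z (q) < 13 / 10 * a₀} ≃
                      ↥{p : EuclideanSpace ℝ (Fin 3) | p ∈ hcpStacking a₀ h₀ ∧ p ≠ 0 ∧ ‖p‖ < 13 / 10 * a₀},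
                    ∀ t : ↥{z : EuclideanSpace ℝ (Fin 3) | z ∈ P.points ∧ z ≠ q ∧ dist z (q) < 13 / 10 * a₀},
                      dist ((t : EuclideanSpace ℝ (Fin 3)) - q)
                        (A ((e t : ↥{p : EuclideanSpace ℝ (Fin 3) | p ∈ hcpStacking a₀ h₀ ∧ p ≠ 0 ∧ ‖p‖ < 13 / 10 * a₀}) : EuclideanSpace ℝ (Fin 3))) ≤ τ) ∨
                  (∃ e : ↥{z : EuclideanSpace ℝ (Fin 3) | z ∈ P.points ∧ z ≠ q ∧ dist z (q) < 13 / 10 * a₀} ≃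
                      ↥{p : EuclideanSpace ℝ (Fin 3) | p ∈ fccStacking a₀ h₀ ∧ p ≠ 0 ∧ ‖p‖ < 13 / 10 * a₀},
                    ∀ t : ↥{z : EuclideanSpace ℝ (Fin 3) | z ∈ P.points ∧ z ≠ q ∧ dist z (q) < 13 / 10 * a₀},
                      dist ((t : EuclideanSpace ℝ (Fin 3)) - q)
                        (A ((e t : ↥{p : EuclideanSpace ℝ (Fin 3) | p ∈ fccStacking a₀ h₀ ∧ p ≠ 0 ∧ ‖p‖ < 13 / 10 * a₀}) : EuclideanSpace ℝ (Fin 3))) ≤ τ))).card : ℝ)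
          ≤ (P.motif.card : ℝ) * (P.energyPerParticle lennardJones - (⨅ Q : PeriodicConfiguration 3, Q.energyPerParticle lennardJones)) := by
  rintro ⟨g, hg, hG⟩ ⟨a₀, h₀, hb1, hb2, hb3, C, hC, hE⟩
  refine ⟨a₀, h₀, hb1, hb2, hb3, fun τ hτ hτ1 => ?_⟩
  obtain ⟨c, hc, hcP⟩ := hE τ hτ hτ1
  refine ⟨min g (c * g / (g + C)) / 2,
    div_pos (lt_min hg (div_pos (mul_pos hc hg) (by linarith))) two_pos, fun P hsep => ?_⟩
  have hm : (0 : ℝ) < (P.motif.card : ℝ) := Nat.cast_pos.2 (Finset.card_pos.2 P.motif_nonempty)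
  exact min_div_two_mul_le hg hc hC hm (hG P hsep) (hcP P hsep)
    (card_filter_le_card_filter_and_add _ _ _) (Nat.cast_nonneg _) (Nat.cast_nonneg _)

end Summit.AtomisticToContinuum.Crystallization.Theorems.SummedShellPricingTorusGlue

end
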